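import Literature.AnabelianGeometry.EtaleTheta.Discharge.Sec2Cor218LevelsOfModel
import HarnessLib

/-!
# [EtTh] Cor. 2.18 (iv), "[hence a bijection if `N/M` is odd]", FOR THE §1 MODEL TOWER — down to the
# FACT-policy floor of layer L2 (proof-only)

Mochizuki, *The Étale Theta Function and its Frobenioid-theoretic Manifestations* [EtTh], Publ. RIMS
**45** (2009), §2, Cor. 2.18 (iv) pp.61–62 (locators `p.N` = PDF pages of the PRIMS text; bib key
`MochizukiEtTh2009`). PROOF-ONLY companion (no `def`, no new named fact, no instance) of
`ThetaSystems.lean` (seat abc-iut-L2-t2: the named fact `ThetaEnvTower.Cor218_iv_bijective_of_odd`) and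
of `Discharge/Sec2Cor218LevelsOfModel.lean` (seat abc-iut-f-150:
`cor218_iv_bijective_of_odd_of_model_of_slim`). Cell `abc-iut`, block F fact-proving wave, seat
abc-iut-f-153 (tranche 153), FROZEN FACT-LIST row **F-0647**
`Literature.AnabelianGeometry.EtaleTheta.ThetaEnvTower.Cor218_iv_bijective_of_odd` (kernel_closedness =
parametrised; universal closure REFUTED by seat abc-iut-w5-d071's
`ThetaEnvTower.not_forall_cor218_iv_bijective_of_odd`, rule R5: consumable at named instances only).

THE NAMED INSTANCE. `cor218_iv_bijective_of_odd_of_model_of_facts`: the odd-bijectivity clause of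
Cor. 2.18 (iv) for the §1 MODEL TOWER `C.thetaEnvTower τ hC hS` of `X̲̲` (seat abc-iut-L2-t8), with the
two level-wise first-half clauses of Cor. 2.18 (iv) (`Cor218_iv_surjective`, `Cor218_iv_fibre`) — the
residual binders of abc-iut-f-150's `cor218_iv_bijective_of_odd_of_model_of_slim` — SUPPLIED by the lane-C2
theorems of layer L2 (abc-iut-L2-t10's `rigidData_cor218_iv_surjective` with abc-iut-L2-d1's
`hcoll_of_cor219_iii`; abc-iut-L2-t10's `cor218_iv_fibre_of_prop214_i` with abc-iut-L5-t14 /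
abc-iut-L2-t8's `rigidData_prop214_i`), exactly as in abc-iut-f-150's
`exists_iso_of_systems_model_of_facts`. The residual inputs are then the FACT-policy floor shared by
the whole [EtTh] §2 model lane (abc-iut-L2-d1's `cor219_ii_model_of_facts`): Prop. 1.5 (ii), (iii)
(named §1 facts `Prop15ii`, `Prop15iii`), temp-slimness of `Π^tp_X` ([SemiAnbd] Ex. 3.10), openness of
`Π^tp_X → G_K`, Cor. 2.18 (i) at the chain levels (anabelian input), constant multiple rigidity as the
named fact `ThetaEnvTower.Cor219_iii`, and the §1 origin clauses `IsEtThOrigin`, `hYcl`.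

HONEST FRAMING: a by-name assembly of landed theorems; the hypotheses are not asserted; [EtTh] is
refereed and its Cor. 2.18 (iv) is neither endorsed nor disputed here; no side is taken on
[IUTchIII] Cor. 3.12; typed ≠ proved elsewhere.
-/

noncomputable section

namespace Literature.AnabelianGeometry.EtaleTheta

open Literature.AnabelianGeometry.SemiGraphs
open Literature.AlgebraicGeometry.Frobenioids (IsSlimGroup)

namespace ThetaSetting.EtaleThetaData.DoubleUnderline

variable {p : ℕ} [Fact p.Prime] {D : ThetaSetting p} {E : D.EtaleThetaData} {l : ℕ}
  (C : E.DoubleUnderline l) {Es : Set ℕ+} (τ : D.CyclotomeTower l Es)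

/-- **[EtTh] Cor. 2.18 (iv), "[hence is a bijection if `N/M` is odd]", FOR THE §1 MODEL TOWER of `X̲̲`,
modulo the FACT-policy floor of layer L2 only** (FACT-LIST F-0647 at the named instance): for
`M ∣ M'` in the chain `Es` with `M'/M` odd, `Aut^μ(𝕄_{M'}) → Aut^μ(𝕄_M)` is bijective (lifting up to
`μ_M`-conjugacy, kernel trivial modulo `μ_{M'}`-conjugacy) — from Prop. 1.5 (ii), (iii), temp-slimness of
`Π^tp_X`, openness of `Π^tp_X → G_K`, Cor. 2.18 (i) at the chain levels, `ThetaEnvTower.Cor219_iii`,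
`IsEtThOrigin`, `hYcl`; the level-wise `Cor218_iv_surjective` / `Cor218_iv_fibre` and the reduction and
Cor. 2.18 (ii)/(iii) clauses are the landed theorems of lane C2, BY NAME.
[cite: MochizukiEtTh2009, Cor 2.18(iv) p.62] -/
theorem cor218_iv_bijective_of_odd_of_model_of_facts (hC : D.Compat) (hS : D.Sec2Hyps)
    (h15 : Prop15iii E hC) (h15ii : Prop15ii E.toKummerData hC) (L : C.CuspLabels)
    (hslimX : IsSlimGroup D.PiTemp) (haugOpen : IsOpenMap D.aug)
    (h218i : ∀ M : Es, (C.rigidData (τ.mod M) hC hS h15 L).Cor218_i)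
    (h219iii : (C.thetaEnvTower τ hC hS).Cor219_iii) (hO : D.IsEtThOrigin)
    (hYcl : (D.DtpY.map D.toHat.toMonoidHom).topologicalClosure ≤
      D.DtpY.map D.toHat.toMonoidHom ⊔ (⁅⁅D.DeltaHat, D.DeltaHat⁆, D.DeltaHat⁆).topologicalClosure) :
    (C.thetaEnvTower τ hC hS).Cor218_iv_bijective_of_odd :=
  C.cor218_iv_bijective_of_odd_of_model_of_slim τ hC hS hslimX haugOpen
    (fun M => (RigidData.cor218_iv_surjective_iff _).1
      (C.rigidData_cor218_iv_surjective τ M hC hS h15 h15ii L _ rfl (h218i M)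
        (C.hcoll_of_cor219_iii τ hC hS h15 L h218i h219iii M)))
    (fun M => (RigidData.cor218_iv_fibre_iff _).1
      ((C.rigidData (τ.mod M) hC hS h15 L).cor218_iv_fibre_of_prop214_i
        (C.rigidData_prop214_i (τ.mod M) hC hS h15 L hO (D.dtpYTheta_comm hO) hYcl)))

end ThetaSetting.EtaleThetaData.DoubleUnderline

end Literature.AnabelianGeometry.EtaleTheta

end
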